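import Summits.SmoothPoincare4.SmoothPoincare4.Theorems.GompfEulerCharacteristicQuestionCalibrated
import Summits.SmoothPoincare4.SmoothPoincare4.Theorems.SymplecticOrigamiNoGenusTwoDoorOfGompfQuestion
import Literature.Geometry.Symplectic.TaubesCanonicalClassSymplecticCurveFourProofs
import Literature.Geometry.Symplectic.HirzebruchSignatureAlmostComplexFour
import Literature.AlgebraicTopology.SingularHomology.IntersectionFormPositiveRealClass
import Literature.AlgebraicTopology.SingularHomology.HomologyRingChange
import Literature.Geometry.Symplectic.EulerCharacteristicAddSignatureOfSymplecticFourOfHirzebruch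
import HarnessLib

/-!
# `NoGenusTwoDoor` from Gompf's question / Li's BMY conjecture — CHOICE-FREE, SIGN-CALIBRATED
bridge; and the calibration `NoGenusTwoDoor ⟺ "symplectic b₂ = 1 ⇒ ℚ-homology ℂP²"` modulo
Hirzebruch only (crux stmt-SmoothPoincare4-7842, route `SymplecticOrigami`, lead c10)

Sequel to `SymplecticOrigamiNoGenusTwoDoorOfGompfQuestion.lean` (p151968), whose bridge ran
through the named facts `one_le_bPlus` and `liu1996_complexProjectivePlane_of_rank_two_eq_one`,
since deprecated as MISSTATED (read against the `Classical.choice` orientation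
`symplecticOrientation s`; verdict clean-up of `MinimalSymplecticFourBPlusOne.lean`, 2026-08-17).
Here every sign-sensitive quantity is read against THE symplectic orientation `μ`
(`μ.IsSymplecticOrientationOf s hs hcl`, which exists unconditionally —
`exists_isSymplecticOrientationOf` — and has `b⁺ ≥ 1`, `one_le_sigPos_of_isSymplecticOrientationOf`)
and an `s`-compatible `J` with calibrated canonical class `ε • K_J` (`IsCalibratedChernSign ε`,
`classDotOmega`), exactly as in `liu1996_complexProjectivePlane_of_rank_two_eq_one_calibrated`, and
the conjectures are the calibrated, corrected obligation nodes
`GompfEulerCharacteristicQuestionCalibrated ε` / `LiSymplecticBMYConjectureCalibrated ε` of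
`GompfEulerCharacteristicQuestionCalibrated.lean`.  For a DOOR `(N, s)` — closed connected symplectic,
`(rank H₁, rank H₂) = (2, 1)` — with symplectic orientation `μ` and compatible `J` (all sorry-free):

* `minimal_of_door` — `μ`-minimality: the intersection form of `μ` is `⟨+1⟩`
  (`exists_linearEquiv_intersectionForm_of_door`), so no `μ`-dual class of an embedded sphere has
  square `-1`;
* `classDotOmega_nonneg_of_door` — `K · [ω] ≥ 0` for `K = ε • K_J`, from the calibrated Liu `b₂ = 1`
  theorem (`nonempty_diffeomorph_complexProjectivePlane_or_classDotOmega_nonneg`) and `N ≇ ℂP²`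
  (`not_nonempty_diffeomorph_complexProjectivePlane_of_door`, p151968);
* `cupPairing_canonicalClass_self_eq_one_of_door` — `K_J · K_J = 1` (Hirzebruch `c₁² = 2χ + 3σ` on
  the complex orientation `μ` of `J`; `(χ, σ) = (-1, 1)`);
* `exists_classDotOmega_eq_and_symplecticPairing_eq_sq_of_door`, `classDotOmega_pos_of_door` —
  `[s] = t • (K ⊗ 1)` in `H²(N; ℝ)` (the tree's `span_ringChange_eq_top`; `K` generates
  `H²(N; ℤ)/T` since `K · K = 1`), so `K · [ω] = t` and `⟨[s]², [N]_μ⟩ = t² > 0`: `K · [ω] > 0` — a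
  door has symplectic Kodaira dimension `2` (T.-J. Li, arXiv:1511.04831 §4.3.1: "such a manifold has
  `κˢ = 2`");
* `noGenusTwoDoor_of_gompfQuestionCalibrated`, `noGenusTwoDoor_of_liSymplecticBMYCalibrated`
  (registered stubs `stub_noGenusTwoDoor_of_gompfQuestionCalibrated`,
  `stub_noGenusTwoDoor_of_liSymplecticBMYCalibrated`) — **either obligation node implies the crux**,
  modulo exactly: the Chern-sign calibration `IsCalibratedChernSign ε` (Gauss–Bonnet on `S²`,
  McDuff–Salamon Thm. 2.7.1), Liu's calibrated `b₂ = 1` theorem, Hirzebruch's `c₁² = 2χ + 3σ`;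
* `finrank_one_eq_zero_of_rank_two_eq_one_of_noGenusTwoDoor`,
  `noGenusTwoDoor_iff_rationalHomologyCP2` (registered stub
  `stub_noGenusTwoDoor_iff_rationalHomologyCP2_of_hirzebruch`) — **modulo Hirzebruch ONLY, the crux is
  EQUIVALENT to "every closed symplectic `4`-manifold with `b₂ = 1` has `b₁ = 0`"** (a rational
  homology `ℂP²`): `0 ≤ c₁ · c₁ = 2χ + 3σ = 9 - 4b₁` bounds `b₁ ≤ 2` (Li–Liu 2001, p. 353), `b₁ = 2` is
  a door, and `1 + b₁ + b⁺` is even (`even_one_add_bOne_add_bPlus_of_symplectic_four_of_hirzebruch`).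

Sources: [LiKodairaLowDim2015] §4.3.1, §4.4.1; [Liu1996] Thm. B; [LiLiu2001] p. 353;
[McDuffSalamon2017] Thm. 2.7.1, Rem. 4.1.10, Def. 4.1.4, §13.3; [HatcherAT2002] §3.1, §3.3.
-/

noncomputable section

-- the prescribed namespace `Summit.<P>.<Sub>.…` duplicates `SmoothPoincare4` (P = Sub)
set_option linter.dupNamespace false

open scoped Manifold ContDiff Topology ContinuousMap
open Set Function TopologicalSpace CategoryTheory Limits
open Literature.Geometry.Kaehler (MForm IsSmoothForm IsClosedForm)
open Literature.AlgebraicTopology.SingularHomology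
open Literature.Topology.FourManifolds (singularHomologyZ ComplexProjectivePlane)
open Literature.Geometry.Symplectic
open Summit.SmoothPoincare4.SmoothPoincare4.Theses.SymplecticOrigami (NoGenusTwoDoor)
open Summit.SmoothPoincare4.SmoothPoincare4.Theorems (GompfEulerCharacteristicQuestionCalibrated
  LiSymplecticBMYConjectureCalibrated)
open Summit.SmoothPoincare4.SmoothPoincare4.Theorems.NoGenusTwoDoor.CanonicalCapFilling
  (exists_linearEquiv_intersectionForm_of_door relEuler_eq_neg_one_of_door signature_eq_one_of_door
    sigPos_eq_one_and_sigNeg_eq_zero finrank_singularHomology_three_eq_finrank_one)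
open Summit.SmoothPoincare4.SmoothPoincare4.Theorems.NoGenusTwoDoor.GompfBridge
  (not_nonempty_diffeomorph_complexProjectivePlane_of_door)

namespace Summit.SmoothPoincare4.SmoothPoincare4.Theorems.NoGenusTwoDoor.Calibrated

section Door

variable {N : Type} [TopologicalSpace N] [T2Space N] [SecondCountableTopology N] [CompactSpace N]
  [ConnectedSpace N] [ChartedSpace (EuclideanSpace ℝ (Fin 4)) N] [IsManifold (𝓡 4) ∞ N]

omit [SecondCountableTopology N] [ConnectedSpace N] in
/-- **A door is minimal, in the symplectic orientation.** For a closed connected `(N, s)` with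
`rank H₂(N; ℤ) = 1` and its symplectic orientation `μ` (`b⁺(μ) ≥ 1`,
`one_le_sigPos_of_isSymplecticOrientationOf`), the intersection form of `μ` is `Q(x, y) = e(x) e(y)`,
so no `μ`-Poincaré-dual class of a smoothly embedded `s`-symplectic sphere has square `-1`
(T.-J. Li 2015 §4.3.1: "`b⁻ = 0` and hence minimal"). [cite: LiKodairaLowDim2015, §4.3.1] -/
theorem minimal_of_door (s : MForm (𝓡 4) N ℝ 2) (hs : IsSmoothForm s) (hcl : IsClosedForm s)
    {μ : HomologicalOrientation ℤ N 4} (hμ : μ.IsSymplecticOrientationOf s hs hcl)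
    (hb2 : Module.finrank ℤ (singularHomology ℤ ℤ N 2) = 1) :
    ∀ (b : Metric.sphere (0 : EuclideanSpace ℝ (Fin 3)) 1 → N)
      (hb : Manifold.IsSmoothEmbedding (𝓡 2) (𝓡 4) ∞ b),
      (∀ y (v : TangentSpace (𝓡 2) y), v ≠ 0 → ∃ w : TangentSpace (𝓡 2) y,
        s (b y) ![mfderiv (𝓡 2) (𝓡 4) b y v, mfderiv (𝓡 2) (𝓡 4) b y w] ≠ 0) →
      ∀ (μS : HomologicalOrientation ℤ (Metric.sphere (0 : EuclideanSpace ℝ (Fin 3)) 1) 2)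
        (σ : singularCohomology ℤ ℤ N 2),
        poincareDualityMap μ two_add_two_eq_four σ =
          singularHomology.map ℤ ℤ ⟨b, hb.isEmbedding.continuous⟩ 2 μS.fundamentalClass →
        cupPairing μ two_add_two_eq_four σ σ ≠ -1 := by
  intro b hb _ μS σ _ hm1
  have hpos : 1 ≤ sigPos (intersectionForm two_add_two_eq_four μ).toQuadraticMap :=
    one_le_sigPos_of_isSymplecticOrientationOf hμ
  obtain ⟨e, he⟩ := exists_linearEquiv_intersectionForm_of_door μ hpos hb2
  have hsq : cupPairing μ two_add_two_eq_four σ σ =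
      e (freeCohomology.mk σ) * e (freeCohomology.mk σ) := by
    rw [← intersectionForm_mk_mk]; exact he _ _
  have h0 : (0 : ℤ) ≤ e (freeCohomology.mk σ) * e (freeCohomology.mk σ) := mul_self_nonneg _
  omega

/-- **`K · [ω] ≥ 0` for a door**, `K = ε • K_J` calibrated: Liu's `b₂ = 1` theorem in calibrated
form (`nonempty_diffeomorph_complexProjectivePlane_or_classDotOmega_nonneg`) leaves `N ≅ ℂP²` or
`K · [ω] ≥ 0`, and a door is not `ℂP²` (`rank H₁ = 2 ≠ 0`). [cite: Liu1996, proof of Theorem B (pp. 578–579)] -/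
theorem classDotOmega_nonneg_of_door {ε : ℤˣ}
    (hL : liu1996_complexProjectivePlane_of_rank_two_eq_one_calibrated ε) (hε : IsCalibratedChernSign ε)
    (s : MForm (𝓡 4) N ℝ 2) (hs : IsSmoothForm s) (hcl : IsClosedForm s)
    {μ : HomologicalOrientation ℤ N 4} (hμ : μ.IsSymplecticOrientationOf s hs hcl)
    {J : AlmostComplexStructure (𝓡 4) ∞ N} (hJ : J.IsCompatibleWith s)
    (hb1 : Module.finrank ℤ (singularHomology ℤ ℤ N 1) = 2)
    (hb2 : Module.finrank ℤ (singularHomology ℤ ℤ N 2) = 1) :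
    0 ≤ classDotOmega μ ((ε : ℤ) • J.canonicalClass) s hs hcl :=
  (nonempty_diffeomorph_complexProjectivePlane_or_classDotOmega_nonneg hL hε s hs hcl hμ hJ hb2).resolve_left
    (not_nonempty_diffeomorph_complexProjectivePlane_of_door hb1)

/-- **`K_J · K_J = 1` for a door** (even in any sign of `K`): Hirzebruch's `⟨c₁ ⌣ c₁, [N]_μ⟩ = 2χ + 3σ`
on the complex orientation `μ` of the compatible `J` (= the symplectic orientation,
`isSymplecticOrientationOf_iff_isComplexOrientationOf`), with `(χ, σ(μ)) = (-1, 1)`.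
[cite: McDuffSalamon2017, Rem. 4.1.10 eq. (4.1.7)] [cite: LiKodairaLowDim2015, §4.3.1] -/
theorem cupPairing_canonicalClass_self_eq_one_of_door
    (hB : hirzebruch_firstChernClass_sq_eq_almostComplex_four)
    (s : MForm (𝓡 4) N ℝ 2) (hs : IsSmoothForm s) (hcl : IsClosedForm s)
    {μ : HomologicalOrientation ℤ N 4} (hμ : μ.IsSymplecticOrientationOf s hs hcl)
    {J : AlmostComplexStructure (𝓡 4) ∞ N} (hJ : J.IsCompatibleWith s)
    (hb1 : Module.finrank ℤ (singularHomology ℤ ℤ N 1) = 2)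
    (hb2 : Module.finrank ℤ (singularHomology ℤ ℤ N 2) = 1) :
    cupPairing μ two_add_two_eq_four J.canonicalClass J.canonicalClass = 1 := by
  have hcx : μ.IsComplexOrientationOf J :=
    (isSymplecticOrientationOf_iff_isComplexOrientationOf hJ hs hcl μ).1 hμ
  have hH := hB N J μ hcx
  have hpos : 1 ≤ sigPos (intersectionForm two_add_two_eq_four μ).toQuadraticMap :=
    one_le_sigPos_of_isSymplecticOrientationOf hμ
  have hχ : relEuler ℤ ℤ N ∅ = -1 := relEuler_eq_neg_one_of_door μ hb1 hb2
  have hσ : μ.signature = 1 := signature_eq_one_of_door μ hpos hb2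
  have hnn : cupPairing μ two_add_two_eq_four J.canonicalClass J.canonicalClass =
      cupPairing μ two_add_two_eq_four J.firstChernClass J.firstChernClass := by
    rw [J.canonicalClass_eq_neg]
    simp only [map_neg, LinearMap.neg_apply, neg_neg]
  rw [hnn, hH, hχ, hσ]
  norm_num

/-- **`K · [ω]` and `[ω]²` of a door in the coordinate of `K = ε • K_J`.** With `K · K = 1`, `K`
generates `H²(N; ℤ)/T ≅ ℤ`, the real class of the form is `[s] = t • (K ⊗ 1)` (integral classes
span `H²(N; ℝ)`, the tree's `span_ringChange_eq_top`), and then `K · [ω] = t`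
(cap–cup adjunction `⟨[s], K ⌢ [N]⟩ = ⟨K ⌣ [s], [N]⟩` through the change of coefficients `ℤ → ℝ`)
and `⟨[s] ⌣ [s], [N]_μ⟩ = t²`. [cite: HatcherAT2002, §3.1 p. 198 and §3.3 p. 249] -/
theorem exists_classDotOmega_eq_and_symplecticPairing_eq_sq_of_door
    (hB : hirzebruch_firstChernClass_sq_eq_almostComplex_four) (ε : ℤˣ)
    (s : MForm (𝓡 4) N ℝ 2) (hs : IsSmoothForm s) (hcl : IsClosedForm s)
    {μ : HomologicalOrientation ℤ N 4} (hμ : μ.IsSymplecticOrientationOf s hs hcl)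
    {J : AlmostComplexStructure (𝓡 4) ∞ N} (hJ : J.IsCompatibleWith s)
    (hb1 : Module.finrank ℤ (singularHomology ℤ ℤ N 1) = 2)
    (hb2 : Module.finrank ℤ (singularHomology ℤ ℤ N 2) = 1) :
    ∃ t : ℝ, classDotOmega μ ((ε : ℤ) • J.canonicalClass) s hs hcl = t ∧
      symplecticPairing μ s hs hcl = t * t := by
  set K : singularCohomology ℤ ℤ N 2 := (ε : ℤ) • J.canonicalClass with hKdef
  have hpos : 1 ≤ sigPos (intersectionForm two_add_two_eq_four μ).toQuadraticMap :=
    one_le_sigPos_of_isSymplecticOrientationOf hμ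
  have hK1 : cupPairing μ two_add_two_eq_four K K = 1 := by
    have h1 := cupPairing_canonicalClass_self_eq_one_of_door hB s hs hcl hμ hJ hb1 hb2
    simp only [hKdef, map_zsmul, LinearMap.smul_apply, smul_eq_mul, h1, mul_one]
    exact Int.units_coe_mul_self ε
  -- `K` generates the rank-one lattice: a coordinate `e'` with `e' (mk K) = 1`
  obtain ⟨e, he⟩ := exists_linearEquiv_intersectionForm_of_door μ hpos hb2
  have hk : e (freeCohomology.mk K) * e (freeCohomology.mk K) = 1 := by
    rw [← he, intersectionForm_mk_mk, hK1]
  obtain ⟨e', he'⟩ : ∃ e' : freeCohomology ℤ N 2 ≃ₗ[ℤ] ℤ, e' (freeCohomology.mk K) = 1 := by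
    rcases mul_self_eq_one_iff.1 hk with h | h
    · exact ⟨e, h⟩
    · exact ⟨e.trans (LinearEquiv.neg ℤ), by simp [h]⟩
  -- the basis `{mk K}` of `H²(N; ℤ)/T` and the spanning of `H²(N; ℝ)` by `K ⊗ 1`
  let bK : Module.Basis Unit ℤ (freeCohomology ℤ N 2) := (Module.Basis.singleton Unit ℤ).map e'.symm
  have hlift : ∀ j : Unit, freeCohomology.mk K = bK j := fun j ↦ by
    change freeCohomology.mk K = e'.symm (Module.Basis.singleton Unit ℤ j)
    rw [Module.Basis.singleton_apply, ← he', LinearEquiv.symm_apply_apply]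
  have hspan := span_ringChange_eq_top (k := 2) (n := 4) two_add_two_eq_four μ bK (fun _ ↦ K) hlift
  set KR : singularCohomology ℝ ℝ N 2 := singularCohomology.ringChange (algebraMap ℤ ℝ) N 2 K with hKR
  have hrange : (Set.range fun _ : Unit ↦ singularCohomology.ringChange (algebraMap ℤ ℝ) N 2 K) = {KR} := by
    ext y; simp [hKR]
  rw [hrange] at hspan
  have hmem : realClassOfClosedForm s hs hcl ∈
      Submodule.span ℝ ({KR} : Set (singularCohomology ℝ ℝ N 2)) := by
    rw [hspan]; exact Submodule.mem_top
  obtain ⟨t, ht⟩ := Submodule.mem_span_singleton.1 hmem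
  have hKK : kroneckerPairing ℝ ℝ N 4 (cupProduct two_add_two_eq_four KR KR) (realFundamentalClass μ) = 1 := by
    rw [realFundamentalClass_eq, hKR, kroneckerPairing_cupProduct_ringChange ℝ two_add_two_eq_four μ K K,
      hK1, map_one]
  refine ⟨t, ?_, ?_⟩
  · -- `K · [ω] = ⟨[s], (K ⌢ [N]) ⊗ 1⟩ = ⟨[s], (K ⊗ 1) ⌢ ([N] ⊗ 1)⟩ = ⟨(K ⊗ 1) ⌣ [s], [N] ⊗ 1⟩ = t`
    have hcoeff : singularHomology.coeffChange (X := N) (Int.castAddHom ℝ) 2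
        (poincareDualityMap μ two_add_two_eq_four K) =
          capProduct two_add_two_eq_four KR (realFundamentalClass μ) := by
      rw [poincareDualityMap_apply, realFundamentalClass_eq, hKR, algebraMap_int_eq]
      exact singularHomology.coeffChange_capProduct (Int.castRingHom ℝ) two_add_two_eq_four K
        μ.fundamentalClass
    rw [classDotOmega_eq, hcoeff, ← kroneckerPairing_cupProduct two_add_two_eq_four, ← ht]
    simp only [map_smul, LinearMap.smul_apply, smul_eq_mul, hKK, mul_one]
  · rw [symplecticPairing_eq, ← ht]
    simp only [map_smul, LinearMap.smul_apply, smul_eq_mul, hKK, mul_one]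

/-- **`K · [ω] > 0` for a door** — with `K · K = 1 > 0` and minimality, a door has symplectic
Kodaira dimension `2` (T.-J. Li 2015, §4.3.1: "such a manifold has `κˢ = 2`"): in the coordinate of
`K`, `K · [ω] = t`, `0 < ⟨[s]², [N]_μ⟩ = t²` (this IS `μ.IsSymplecticOrientationOf s`), so `t ≠ 0`,
and `t ≥ 0` by `classDotOmega_nonneg_of_door`. [cite: LiKodairaLowDim2015, §4.3.1] [cite: Liu1996, proof of Theorem B (pp. 578–579)] -/
theorem classDotOmega_pos_of_door {ε : ℤˣ} (hB : hirzebruch_firstChernClass_sq_eq_almostComplex_four)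
    (hL : liu1996_complexProjectivePlane_of_rank_two_eq_one_calibrated ε) (hε : IsCalibratedChernSign ε)
    (s : MForm (𝓡 4) N ℝ 2) (hs : IsSmoothForm s) (hcl : IsClosedForm s)
    {μ : HomologicalOrientation ℤ N 4} (hμ : μ.IsSymplecticOrientationOf s hs hcl)
    {J : AlmostComplexStructure (𝓡 4) ∞ N} (hJ : J.IsCompatibleWith s)
    (hb1 : Module.finrank ℤ (singularHomology ℤ ℤ N 1) = 2)
    (hb2 : Module.finrank ℤ (singularHomology ℤ ℤ N 2) = 1) :
    0 < classDotOmega μ ((ε : ℤ) • J.canonicalClass) s hs hcl := by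
  obtain ⟨t, ht, hsq⟩ :=
    exists_classDotOmega_eq_and_symplecticPairing_eq_sq_of_door hB ε s hs hcl hμ hJ hb1 hb2
  have hsymp : 0 < symplecticPairing μ s hs hcl := hμ
  have h0 : 0 ≤ classDotOmega μ ((ε : ℤ) • J.canonicalClass) s hs hcl :=
    classDotOmega_nonneg_of_door hL hε s hs hcl hμ hJ hb1 hb2
  rw [ht] at h0 ⊢
  rw [hsq] at hsymp
  rcases h0.lt_or_eq with h | h
  · exact h
  · exfalso; rw [← h, mul_zero] at hsymp; exact lt_irrefl 0 hsymp

omit [SecondCountableTopology N] [IsManifold (𝓡 4) ∞ N] in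
/-- **Euler characteristic at `b₂ = 1`**: a closed connected `ℤ`-oriented `4`-manifold with
`rank H₂(N; ℤ) = 1` has `χ(N) = 3 - 2 rank H₁(N; ℤ)` (`χ = Σ (-1)^k rank H_k`, `rank H₀ =
rank H₄ = 1`, `rank H₃ = rank H₁` by Poincaré duality). [cite: HatcherAT2002, §2.2 p. 146, Thm. 3.26 and Thm. 3.30] -/
theorem relEuler_eq_of_rank_two_eq_one (μ : HomologicalOrientation ℤ N 4)
    (hb2 : Module.finrank ℤ (singularHomology ℤ ℤ N 2) = 1) :
    relEuler ℤ ℤ N ∅ = 3 - 2 * (Module.finrank ℤ (singularHomology ℤ ℤ N 1) : ℤ) := by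
  have h0 : Module.finrank ℤ (singularHomology ℤ ℤ N 0) = 1 :=
    Literature.Topology.FourManifolds.finrank_singularHomology_zero_eq_one_of_connected_four
  have h3 : Module.finrank ℤ (singularHomology ℤ ℤ N 3) = Module.finrank ℤ (singularHomology ℤ ℤ N 1) :=
    finrank_singularHomology_three_eq_finrank_one μ
  have h4 : Module.finrank ℤ (singularHomology ℤ ℤ N 4) = 1 :=
    Literature.Topology.FourManifolds.finrank_singularHomology_four_eq_one μ
  rw [(Literature.Topology.FourManifolds.finRelHomology_of_compactSpace_four N).relEuler_empty_eq_sum]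
  simp only [Finset.sum_range_succ, Finset.sum_range_zero, h0, hb2, h3, h4]
  push_cast
  ring

end Door

/-! ### Either obligation node implies the crux -/

/-- **Gompf's question (calibrated, corrected obligation node) implies `NoGenusTwoDoor`**, modulo
exactly the Chern-sign calibration `IsCalibratedChernSign ε` (Gauss–Bonnet on `S²`,
McDuff–Salamon Thm. 2.7.1), Liu's calibrated `b₂ = 1` theorem and Hirzebruch's `c₁² = 2χ + 3σ`: a
door, with its symplectic orientation (which exists, `exists_isSymplecticOrientationOf`) and a
compatible `J`, is minimal, has `K · [ω] ≥ 0`, `K · K = 1 ≥ 0` and `χ = -1 < 0`.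
[cite: Kotschick2006, p. 3 (arXiv version)] [cite: Liu1996, Theorem B and pp. 578–579]
[cite: McDuffSalamon2017, Thm. 2.7.1; Rem. 4.1.10 eq. (4.1.7)] -/
theorem noGenusTwoDoor_of_gompfQuestionCalibrated {ε : ℤˣ}
    (hG : GompfEulerCharacteristicQuestionCalibrated ε) (hε : IsCalibratedChernSign ε)
    (hL : liu1996_complexProjectivePlane_of_rank_two_eq_one_calibrated ε)
    (hB : hirzebruch_firstChernClass_sq_eq_almostComplex_four) : NoGenusTwoDoor := by
  intro N _ _ _ _ _ _ _ s hs hcl hnd ⟨hb1, hb2⟩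
  have hb1' : Module.finrank ℤ (singularHomology ℤ ℤ N 1) = 2 := hb1
  have hb2' : Module.finrank ℤ (singularHomology ℤ ℤ N 2) = 1 := hb2
  obtain ⟨μ, hμ⟩ := exists_isSymplecticOrientationOf s hs hcl hnd
  have hJ : (compatibleAlmostComplexStructureOf s hs hnd).IsCompatibleWith s :=
    isCompatibleWith_compatibleAlmostComplexStructureOf s hs hnd
  have hχ : relEuler ℤ ℤ N ∅ = -1 := relEuler_eq_neg_one_of_door μ hb1' hb2'
  have hKK : cupPairing μ two_add_two_eq_four (compatibleAlmostComplexStructureOf s hs hnd).canonicalClass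
      (compatibleAlmostComplexStructureOf s hs hnd).canonicalClass = 1 :=
    cupPairing_canonicalClass_self_eq_one_of_door hB s hs hcl hμ hJ hb1' hb2'
  have h0 : 0 ≤ relEuler ℤ ℤ N ∅ :=
    hG hε N s hs hcl μ hμ _ hJ (minimal_of_door s hs hcl hμ hb2')
      (classDotOmega_nonneg_of_door hL hε s hs hcl hμ hJ hb1' hb2') (by rw [hKK]; exact zero_le_one)
  omega

/-- **Li's symplectic BMY conjecture (calibrated obligation node) implies `NoGenusTwoDoor`**, modulo
the same three printed inputs: a door is minimal with `K · [ω] > 0`, `K · K = 1 > 0` (symplectic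
Kodaira dimension `2`) and `χ = -1`, and `1 ≤ 3 · (-1)` is false (T.-J. Li 2015, Conj. 4.11 and
§4.3.1). [cite: LiKodairaLowDim2015, §4.4.1 Conj. 4.11 and §4.3.1] -/
theorem noGenusTwoDoor_of_liSymplecticBMYCalibrated {ε : ℤˣ}
    (hBMY : LiSymplecticBMYConjectureCalibrated ε) (hε : IsCalibratedChernSign ε)
    (hL : liu1996_complexProjectivePlane_of_rank_two_eq_one_calibrated ε)
    (hB : hirzebruch_firstChernClass_sq_eq_almostComplex_four) : NoGenusTwoDoor := by
  intro N _ _ _ _ _ _ _ s hs hcl hnd ⟨hb1, hb2⟩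
  have hb1' : Module.finrank ℤ (singularHomology ℤ ℤ N 1) = 2 := hb1
  have hb2' : Module.finrank ℤ (singularHomology ℤ ℤ N 2) = 1 := hb2
  obtain ⟨μ, hμ⟩ := exists_isSymplecticOrientationOf s hs hcl hnd
  have hJ : (compatibleAlmostComplexStructureOf s hs hnd).IsCompatibleWith s :=
    isCompatibleWith_compatibleAlmostComplexStructureOf s hs hnd
  have hχ : relEuler ℤ ℤ N ∅ = -1 := relEuler_eq_neg_one_of_door μ hb1' hb2'
  have hKK : cupPairing μ two_add_two_eq_four (compatibleAlmostComplexStructureOf s hs hnd).canonicalClass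
      (compatibleAlmostComplexStructureOf s hs hnd).canonicalClass = 1 :=
    cupPairing_canonicalClass_self_eq_one_of_door hB s hs hcl hμ hJ hb1' hb2'
  have h := hBMY hε N s hs hcl μ hμ _ hJ (minimal_of_door s hs hcl hμ hb2')
    (classDotOmega_pos_of_door hB hL hε s hs hcl hμ hJ hb1' hb2') (by rw [hKK]; exact one_pos)
  rw [hKK, hχ] at h
  omega

/-! ### Calibration: modulo Hirzebruch alone, the crux is "symplectic `b₂ = 1` ⇒ `b₁ = 0`" -/

section RationalHomologyCP2

variable {N : Type} [TopologicalSpace N] [T2Space N] [SecondCountableTopology N] [CompactSpace N]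
  [ConnectedSpace N] [ChartedSpace (EuclideanSpace ℝ (Fin 4)) N] [IsManifold (𝓡 4) ∞ N]

/-- **`NoGenusTwoDoor` makes every closed symplectic `b₂ = 1` manifold a rational homology `ℂP²`**,
granted only Hirzebruch's `c₁² = 2χ + 3σ`: for the symplectic orientation `μ` (`b⁺(μ) ≥ 1`, hence
`Q_μ = ⟨+1⟩` at `b₂ = 1`) and a compatible `J`, `0 ≤ ⟨c₁ ⌣ c₁, [N]_μ⟩ = e(c₁)² = 2χ + 3σ = 9 - 4b₁`
gives `b₁ ≤ 2` (Li–Liu 2001, p. 353: "if `M` is non-ruled, then `b₁(M) ≤ 2`"), `b₁ = 2` is a door,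
and `1 + b₁ + b⁺` is even (`even_one_add_bOne_add_bPlus_of_symplectic_four_of_hirzebruch`), so
`b₁ = 0`. [cite: LiLiu2001, p. 353] [cite: McDuffSalamon2017, §13.3 p. 527 and Rem. 13.3.5; Rem. 4.1.10] -/
theorem finrank_one_eq_zero_of_rank_two_eq_one_of_noGenusTwoDoor (hD : NoGenusTwoDoor)
    (hB : hirzebruch_firstChernClass_sq_eq_almostComplex_four)
    (s : MForm (𝓡 4) N ℝ 2) (hs : IsSmoothForm s) (hcl : IsClosedForm s)
    (hnd : ∀ x (v : TangentSpace (𝓡 4) x), v ≠ 0 → ∃ w : TangentSpace (𝓡 4) x, s x ![v, w] ≠ 0)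
    (hb2 : Module.finrank ℤ (singularHomology ℤ ℤ N 2) = 1) :
    Module.finrank ℤ (singularHomology ℤ ℤ N 1) = 0 := by
  obtain ⟨μ, hμ⟩ := exists_isSymplecticOrientationOf s hs hcl hnd
  set J := compatibleAlmostComplexStructureOf s hs hnd with hJdef
  have hJ : J.IsCompatibleWith s := isCompatibleWith_compatibleAlmostComplexStructureOf s hs hnd
  have hcx : μ.IsComplexOrientationOf J :=
    (isSymplecticOrientationOf_iff_isComplexOrientationOf hJ hs hcl μ).1 hμ
  have hH := hB N J μ hcx
  have hpos : 1 ≤ sigPos (intersectionForm two_add_two_eq_four μ).toQuadraticMap :=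
    one_le_sigPos_of_isSymplecticOrientationOf hμ
  obtain ⟨hsp, -⟩ := sigPos_eq_one_and_sigNeg_eq_zero μ hpos hb2
  have hσ : μ.signature = 1 := signature_eq_one_of_door μ hpos hb2
  have hχ := relEuler_eq_of_rank_two_eq_one μ hb2
  -- `c₁ · c₁ = e(c₁)² ≥ 0` in the rank-one lattice `⟨+1⟩`
  obtain ⟨e, he⟩ := exists_linearEquiv_intersectionForm_of_door μ hpos hb2
  have hsq : cupPairing μ two_add_two_eq_four J.firstChernClass J.firstChernClass =
      e (freeCohomology.mk J.firstChernClass) * e (freeCohomology.mk J.firstChernClass) := by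
    rw [← intersectionForm_mk_mk]; exact he _ _
  have h0 : (0 : ℤ) ≤ e (freeCohomology.mk J.firstChernClass) * e (freeCohomology.mk J.firstChernClass) :=
    mul_self_nonneg _
  have hb1le : Module.finrank ℤ (singularHomology ℤ ℤ N 1) ≤ 2 := by
    have : (0 : ℤ) ≤ 2 * relEuler ℤ ℤ N ∅ + 3 * μ.signature := by rw [← hH, hsq]; exact h0
    rw [hχ, hσ] at this
    omega
  -- `b₁ = 2` is a door; `b₁` is even since `1 + b₁ + b⁺(μ)` is even and `b⁺(μ) = 1`
  have hne2 : Module.finrank ℤ (singularHomology ℤ ℤ N 1) ≠ 2 := fun h2 ↦ hD N s hs hcl hnd ⟨h2, hb2⟩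
  have hev := even_one_add_bOne_add_bPlus_of_symplectic_four_of_hirzebruch hB N s hs hcl hnd μ hμ
  rw [hsp] at hev
  rcases Nat.even_or_odd (Module.finrank ℤ (singularHomology ℤ ℤ N 1)) with ⟨k, hk⟩ | ⟨k, hk⟩
  · omega
  · exfalso
    rw [hk] at hev
    apply Nat.not_even_iff_odd.2 _ hev
    exact ⟨k + 1, by ring⟩

/-- **Modulo Hirzebruch's `c₁² = 2χ + 3σ` alone, the crux is EQUIVALENT to "every closed symplectic
`4`-manifold with `b₂ = 1` has `b₁ = 0`"** (a rational homology `ℂP²`) — the form in which the open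
problem is usually quoted; the `⇐` direction is trivial. [cite: LiKodairaLowDim2015, §4.3.1] [cite: LiLiu2001, p. 353] -/
theorem noGenusTwoDoor_iff_rationalHomologyCP2 (hB : hirzebruch_firstChernClass_sq_eq_almostComplex_four) :
    NoGenusTwoDoor ↔
      ∀ (N : Type) [TopologicalSpace N] [T2Space N] [SecondCountableTopology N] [CompactSpace N]
        [ConnectedSpace N] [ChartedSpace (EuclideanSpace ℝ (Fin 4)) N] [IsManifold (𝓡 4) ∞ N]
        (s : MForm (𝓡 4) N ℝ 2) (hs : IsSmoothForm s) (hcl : IsClosedForm s)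
        (hnd : ∀ x (v : TangentSpace (𝓡 4) x), v ≠ 0 → ∃ w : TangentSpace (𝓡 4) x, s x ![v, w] ≠ 0),
        Module.finrank ℤ (singularHomology ℤ ℤ N 2) = 1 →
          Module.finrank ℤ (singularHomology ℤ ℤ N 1) = 0 := by
  refine ⟨fun hD N _ _ _ _ _ _ _ s hs hcl hnd hb2 ↦
    finrank_one_eq_zero_of_rank_two_eq_one_of_noGenusTwoDoor hD hB s hs hcl hnd hb2, fun h ↦ ?_⟩
  intro N _ _ _ _ _ _ _ s hs hcl hnd ⟨hb1, hb2⟩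
  have hb1' : Module.finrank ℤ (singularHomology ℤ ℤ N 1) = 2 := hb1
  have := h N s hs hcl hnd hb2
  omega

end RationalHomologyCP2

/-! ### Registered sub-goals of the crux item (one-line forms) -/
/-- **Registered sub-goal `stub_noGenusTwoDoor_of_gompfQuestionCalibrated`**: for every Chern sign
`ε`, Gompf's question (calibrated node), the calibration of `ε`, Liu's calibrated `b₂ = 1` theorem
and Hirzebruch's `c₁² = 2χ + 3σ` imply the crux. [cite: Kotschick2006, p. 3 (arXiv version)] -/
theorem stub_noGenusTwoDoor_of_gompfQuestionCalibrated : ∀ (ε : ℤˣ), Summit.SmoothPoincare4.SmoothPoincare4.Theorems.GompfEulerCharacteristicQuestionCalibrated ε → Literature.Geometry.Symplectic.IsCalibratedChernSign ε → Literature.Geometry.Symplectic.liu1996_complexProjectivePlane_of_rank_two_eq_one_calibrated ε → Literature.Geometry.Symplectic.hirzebruch_firstChernClass_sq_eq_almostComplex_four → Summit.SmoothPoincare4.SmoothPoincare4.Theses.SymplecticOrigami.NoGenusTwoDoor :=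
  fun _ε hG hε hL hB => noGenusTwoDoor_of_gompfQuestionCalibrated hG hε hL hB

/-- **Registered sub-goal `stub_noGenusTwoDoor_of_liSymplecticBMYCalibrated`**: for every Chern sign
`ε`, Li's BMY conjecture (calibrated node), the calibration of `ε`, Liu's calibrated `b₂ = 1` theorem
and Hirzebruch imply the crux. [cite: LiKodairaLowDim2015, §4.4.1 Conj. 4.11 and §4.3.1] -/
theorem stub_noGenusTwoDoor_of_liSymplecticBMYCalibrated : ∀ (ε : ℤˣ), Summit.SmoothPoincare4.SmoothPoincare4.Theorems.LiSymplecticBMYConjectureCalibrated ε → Literature.Geometry.Symplectic.IsCalibratedChernSign ε → Literature.Geometry.Symplectic.liu1996_complexProjectivePlane_of_rank_two_eq_one_calibrated ε → Literature.Geometry.Symplectic.hirzebruch_firstChernClass_sq_eq_almostComplex_four → Summit.SmoothPoincare4.SmoothPoincare4.Theses.SymplecticOrigami.NoGenusTwoDoor :=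
  fun _ε hBMY hε hL hB => noGenusTwoDoor_of_liSymplecticBMYCalibrated hBMY hε hL hB

/-- **Registered sub-goal `stub_noGenusTwoDoor_iff_rationalHomologyCP2_of_hirzebruch`**: modulo
Hirzebruch alone, the crux is "symplectic `b₂ = 1` ⇒ `b₁ = 0`". [cite: LiKodairaLowDim2015, §4.3.1] -/
theorem stub_noGenusTwoDoor_iff_rationalHomologyCP2_of_hirzebruch : Literature.Geometry.Symplectic.hirzebruch_firstChernClass_sq_eq_almostComplex_four → (Summit.SmoothPoincare4.SmoothPoincare4.Theses.SymplecticOrigami.NoGenusTwoDoor ↔ ∀ (N : Type) [TopologicalSpace N] [T2Space N] [SecondCountableTopology N] [CompactSpace N] [ConnectedSpace N] [ChartedSpace (EuclideanSpace ℝ (Fin 4)) N] [IsManifold (𝓡 4) ∞ N] (s : Literature.Geometry.Kaehler.MForm (𝓡 4) N ℝ 2) (hs : Literature.Geometry.Kaehler.IsSmoothForm s) (hcl : Literature.Geometry.Kaehler.IsClosedForm s) (hnd : ∀ x (v : TangentSpace (𝓡 4) x), v ≠ 0 → ∃ w : TangentSpace (𝓡 4) x, s x ![v, w] ≠ 0),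 Module.finrank ℤ (Literature.AlgebraicTopology.SingularHomology.singularHomology ℤ ℤ N 2) = 1 → Module.finrank ℤ (Literature.AlgebraicTopology.SingularHomology.singularHomology ℤ ℤ N 1) = 0) :=
  fun hB => noGenusTwoDoor_iff_rationalHomologyCP2 hB

end Summit.SmoothPoincare4.SmoothPoincare4.Theorems.NoGenusTwoDoor.Calibrated

end
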